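import Summits.Ventures.QEC.Thresholds.DepolarizingThresholds
import Summits.Ventures.QEC.Thresholds.ToricCodeThresholdFisherSykes
import Literature.InformationTheory.QuantumCodes.ToricCodeDuality
import HarnessLib

/-!
# The toric code, `X`-SECTOR (bit flips, plaquette syndrome) and DEPOLARIZING noise: every certified `Z`-sector
# threshold transfers by lattice duality — `p_c^X > .0322`, `p_c^depol > .0483` (kernel, unconditional)

Venture QEC, `Summits/Ventures/QEC/Thresholds/` (LADDER-QEC rung Q5, PARTITION row 09; qec-type-09 gen 3). The cell's toric
threshold theorems (`ToricCodeThresholdUnconditional.lean`, `ToricCodeThresholdFisherSykes.lean`: `toricFailureFamily D`,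
phase flips decoded from the star syndrome) are `Z`-sector statements. By the lattice self-duality
(`Literature/…/ToricCodeDuality.lean`: `xFailureProb_eq_failureProb_dualDecoder`, `isMinWeight_dualDecoder`, over the
tree's `ToricCode.dualEdge`) the `X`-sector failure family of ANY decoder family `DX` of the plaquette syndrome IS the
`Z`-sector family of the conjugate decoders (`xFailureFamily_toricCode`), and minimum weight is preserved — so:

* `toric_x_isThresholdLowerBound_of_z` — every `Z`-sector threshold theorem quantified over all minimum-weight decoder
  families yields the same bound for the `X`-sector; instances `toric_x_isThresholdLowerBound_three` (`p₀(3)`),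
  `toric_x_isThresholdLowerBound_fisherSykes` (`p₀(2.832)`, decimal `toric_x_accuracyThreshold_gt_0322`),
  `toric_x_isThresholdLowerBound_PT2000_of_bounds` (`p₀(2.679193)`, CONDITIONAL on
  `SAW.Zd.BDGS2012_connectiveConstant_two_bounds` exactly like its `Z` twin);
* `zFailureFamily_toricCode` — the census-object `Z`-family of `toricCode (L+1)` is `toricFailureFamily` (`rfl`);
* DEPOLARIZING (the `3/2` rule of `DepolarizingThresholds.lean` on the two sectors): `toric_depolarizing_isThresholdLowerBound`
  — `IsThresholdLowerBound (depolarizingFailureFamily (fun L => toricCode (L+1)) DX DZ) (3/2 · thresholdValue 2.832)` for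
  EVERY pair of minimum-weight decoder families, UNCONDITIONAL; decimal `toric_depolarizing_accuracyThreshold_gt_0483 :
  0.0483 < p_c^depol`; canonical instance; the PT2000-conditional tier `3/2 · p₀(2.679193) > .0541`.

HONEST FRAMING: kernel axioms, no named fact in the unconditional rows, no `native_decide`; the conditional rows carry the
named-fact hypothesis `h` explicitly. Decoder class = sector-wise (correlation-blind) minimum-weight decoding; `3/2` is the
exact marginal conversion of the depolarizing law, not an optimal-decoder statement (numerics `.15`–`.19` are VALIDATED).

## References

* [DennisEtAl2002] E. Dennis, A. Kitaev, A. Landahl, J. Preskill, J. Math. Phys. 43 (2002) 4452, §3.1 (dual lattice),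
  §4.1 (error models), §5.3 (p₀(ν)).
* [MadrasSlade1993] N. Madras, G. Slade, The Self-Avoiding Walk, (1.2.14) (μ₄(ℤ²) = 2.8312 — the Fisher–Sykes constant
  behind `thresholdValue 2.832`).
-/

noncomputable section

namespace Summit.Ventures.QEC.Thresholds

open Filter Topology Finset Matrix
open Literature.InformationTheory.QuantumCodes
open Literature.InformationTheory.QuantumCodes.ToricCode
open Literature.Probability.RandomPlanarGeometry

/-! ### The two sector families of the toric code in census-object form -/

/-- The census-object `Z`-sector family of the toric codes `toricCode (L+1)` IS `toricFailureFamily` (definitional).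
[cite: DennisEtAl2002, §5.2 (Prob_fail)] -/
theorem zFailureFamily_toricCode (D : (L : ℕ) → ZDecoder (L + 1)) :
    zFailureFamily (fun L => toricCode (L + 1)) D = toricFailureFamily D := rfl

/-- **The `X`-sector family is a `Z`-sector family** (lattice duality): for every family `DX` of decoders of the
plaquette syndrome, `xFailureFamily (toricCode ·) DX = toricFailureFamily (dualDecoder ∘ DX)`.
[cite: DennisEtAl2002, §3.1 and §4.1 (X errors on the dual lattice, treated identically)] -/
theorem xFailureFamily_toricCode (DX : (L : ℕ) → Decoder (Syndrome (L + 1)) (Chain (L + 1))) :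
    xFailureFamily (fun L => toricCode (L + 1)) DX = toricFailureFamily fun L => dualDecoder (DX L) := by
  funext L p
  exact xFailureProb_eq_failureProb_dualDecoder (DX L) p

/-- **Transfer principle**: a `Z`-sector threshold bound valid for EVERY minimum-weight decoder family is an `X`-sector
threshold bound for every minimum-weight decoder family of the plaquette syndrome.
[cite: DennisEtAl2002, §4.1 ("we may treat X errors and Z errors separately" — identically, by duality)] -/
theorem toric_x_isThresholdLowerBound_of_z {p₀ : ℝ}
    (hZ : ∀ D : (L : ℕ) → ZDecoder (L + 1),
      (∀ L, (D L).IsMinWeight (syn (L + 1)) (cycles (L + 1)) hammingNorm) →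
        IsThresholdLowerBound (toricFailureFamily D) p₀)
    (DX : (L : ℕ) → Decoder (Syndrome (L + 1)) (Chain (L + 1)))
    (hDX : ∀ L, (DX L).IsMinWeight (toricCode (L + 1)).xSyndrome
      ((toricCode (L + 1)).kerZ : Set (Chain (L + 1))) hammingNorm) :
    IsThresholdLowerBound (xFailureFamily (fun L => toricCode (L + 1)) DX) p₀ := by
  rw [xFailureFamily_toricCode]
  exact hZ _ fun L => isMinWeight_dualDecoder (hDX L)

/-! ### `X`-sector instances -/

/-- **`X`-sector threshold `≥ p₀(3) = (3-2√2)/6 ≈ .0286`** (DKLP's elementary walk count), every minimum-weight decoder family.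
UNCONDITIONAL. [cite: DennisEtAl2002, §5.3 eq. (threshold_2d)] -/
theorem toric_x_isThresholdLowerBound_three (DX : (L : ℕ) → Decoder (Syndrome (L + 1)) (Chain (L + 1)))
    (hDX : ∀ L, (DX L).IsMinWeight (toricCode (L + 1)).xSyndrome
      ((toricCode (L + 1)).kerZ : Set (Chain (L + 1))) hammingNorm) :
    IsThresholdLowerBound (xFailureFamily (fun L => toricCode (L + 1)) DX) ((3 - 2 * Real.sqrt 2) / 6) :=
  toric_x_isThresholdLowerBound_of_z (fun _ hD => toricThreshold_three hD) DX hDX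

/-- **`X`-sector threshold `≥ p₀(2.832) > .0322`** (Fisher–Sykes memory-4 constant, kernel). UNCONDITIONAL.
[cite: MadrasSlade1993, (1.2.14)] [cite: DennisEtAl2002, §5.3 eq. (p_c_2d)] -/
theorem toric_x_isThresholdLowerBound_fisherSykes (DX : (L : ℕ) → Decoder (Syndrome (L + 1)) (Chain (L + 1)))
    (hDX : ∀ L, (DX L).IsMinWeight (toricCode (L + 1)).xSyndrome
      ((toricCode (L + 1)).kerZ : Set (Chain (L + 1))) hammingNorm) :
    IsThresholdLowerBound (xFailureFamily (fun L => toricCode (L + 1)) DX) (thresholdValue 2.832) :=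
  toric_x_isThresholdLowerBound_of_z (fun _ hD => toricThreshold_fisherSykes hD) DX hDX

/-- **`p_c^X > .0322`** (decimal, kernel) for bit flips on the toric code, every minimum-weight decoder family of the
plaquette syndrome. [cite: DennisEtAl2002, §5.3 eq. (p_c_2d)] -/
theorem toric_x_accuracyThreshold_gt_0322 (DX : (L : ℕ) → Decoder (Syndrome (L + 1)) (Chain (L + 1)))
    (hDX : ∀ L, (DX L).IsMinWeight (toricCode (L + 1)).xSyndrome
      ((toricCode (L + 1)).kerZ : Set (Chain (L + 1))) hammingNorm) :
    (0.0322 : ℝ) < accuracyThreshold (xFailureFamily (fun L => toricCode (L + 1)) DX) :=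
  lt_of_lt_of_le thresholdValue_2832_bounds.1
    (le_accuracyThreshold (toric_x_isThresholdLowerBound_fisherSykes DX hDX)
      ((thresholdValue_le_half _).trans (by norm_num)))

/-- **`X`-sector threshold `≥ p₀(2.679193) > .0361`**, CONDITIONAL on the Pönitz–Tittmann bounds
`SAW.Zd.BDGS2012_connectiveConstant_two_bounds` (same trust tier as its `Z` twin `toricThreshold_PT2000_of_bounds`).
[cite: DennisEtAl2002, §5.3 eq. (p_c_2d)] -/
theorem toric_x_isThresholdLowerBound_PT2000_of_bounds (hμ : SAW.Zd.BDGS2012_connectiveConstant_two_bounds)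
    (DX : (L : ℕ) → Decoder (Syndrome (L + 1)) (Chain (L + 1)))
    (hDX : ∀ L, (DX L).IsMinWeight (toricCode (L + 1)).xSyndrome
      ((toricCode (L + 1)).kerZ : Set (Chain (L + 1))) hammingNorm) :
    IsThresholdLowerBound (xFailureFamily (fun L => toricCode (L + 1)) DX) (thresholdValue 2.679193) :=
  toric_x_isThresholdLowerBound_of_z (fun _ hD => toricThreshold_PT2000_of_bounds hμ hD) DX hDX

/-- Non-vacuity of the decoder class on the `X` side: the canonical minimum-weight decoder of the plaquette syndrome.
[cite: DennisEtAl2002, §5.1 (E_min on the dual lattice)] -/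
theorem toric_isMinWeight_minWeight_x (L : ℕ) :
    (Decoder.minWeight (toricCode (L + 1)).xSyndrome hammingNorm).IsMinWeight (toricCode (L + 1)).xSyndrome
      ((toricCode (L + 1)).kerZ : Set (Chain (L + 1))) hammingNorm :=
  (toricCode (L + 1)).isMinWeight_minWeight_xSyndrome

/-! ### Depolarizing noise on the toric code -/

/-- **Depolarizing threshold of the toric code `≥ (3/2)·p₀(2.832) ≈ .0484`**, sector-wise minimum-weight decoding
(ANY minimum-weight decoder family per sector). UNCONDITIONAL, kernel (Fisher–Sykes constant + lattice duality +
the `3/2` marginal rule). [cite: DennisEtAl2002, §4.1 (depolarizing channel vs. independent X/Z errors)] [cite: MadrasSlade1993, (1.2.14)] -/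
theorem toric_depolarizing_isThresholdLowerBound
    (DX : (L : ℕ) → Decoder (Syndrome (L + 1)) (Chain (L + 1))) (DZ : (L : ℕ) → ZDecoder (L + 1))
    (hDX : ∀ L, (DX L).IsMinWeight (toricCode (L + 1)).xSyndrome
      ((toricCode (L + 1)).kerZ : Set (Chain (L + 1))) hammingNorm)
    (hDZ : ∀ L, (DZ L).IsMinWeight (syn (L + 1)) (cycles (L + 1)) hammingNorm) :
    IsThresholdLowerBound (depolarizingFailureFamily (fun L => toricCode (L + 1)) DX DZ)
      (3 / 2 * thresholdValue 2.832) := by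
  have hZ : IsThresholdLowerBound (zFailureFamily (fun L => toricCode (L + 1)) DZ) (thresholdValue 2.832) := by
    rw [zFailureFamily_toricCode]
    exact toricThreshold_fisherSykes hDZ
  have h := depolarizing_isThresholdLowerBound (fun L => toricCode (L + 1)) DX DZ
    (toric_x_isThresholdLowerBound_fisherSykes DX hDX) hZ ((min_le_left _ _).trans (thresholdValue_le_two_thirds _))
  rwa [min_self] at h

/-- **`p_c^depol > .0483`** (decimal, kernel) for the toric code under sector-wise minimum-weight decoding.
[cite: DennisEtAl2002, §4.1 and §5.3] -/
theorem toric_depolarizing_accuracyThreshold_gt_0483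
    (DX : (L : ℕ) → Decoder (Syndrome (L + 1)) (Chain (L + 1))) (DZ : (L : ℕ) → ZDecoder (L + 1))
    (hDX : ∀ L, (DX L).IsMinWeight (toricCode (L + 1)).xSyndrome
      ((toricCode (L + 1)).kerZ : Set (Chain (L + 1))) hammingNorm)
    (hDZ : ∀ L, (DZ L).IsMinWeight (syn (L + 1)) (cycles (L + 1)) hammingNorm) :
    (0.0483 : ℝ) < accuracyThreshold (depolarizingFailureFamily (fun L => toricCode (L + 1)) DX DZ) := by
  have h := thresholdValue_2832_bounds.1
  refine lt_of_lt_of_le (by linarith)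
    (le_accuracyThreshold (toric_depolarizing_isThresholdLowerBound DX DZ hDX hDZ) ?_)
  have := thresholdValue_le_half (2.832 : ℝ)
  linarith

/-- Canonical instance: minimum-weight decoding of both syndromes of the toric code has depolarizing threshold
`≥ (3/2)·p₀(2.832)`. UNCONDITIONAL. [cite: DennisEtAl2002, §4.1 and §5.1] -/
theorem toric_depolarizing_isThresholdLowerBound_minWeight :
    IsThresholdLowerBound
      (depolarizingFailureFamily (fun L => toricCode (L + 1))
        (fun L => Decoder.minWeight (toricCode (L + 1)).xSyndrome hammingNorm)
        fun L => Decoder.minWeight (syn (L + 1)) hammingNorm)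
      (3 / 2 * thresholdValue 2.832) :=
  toric_depolarizing_isThresholdLowerBound _ _ toric_isMinWeight_minWeight_x fun L => ToricCode.isMinWeight_minWeight (L + 1)

/-- **Depolarizing threshold `≥ (3/2)·p₀(2.679193) > .0541`, CONDITIONAL** on the Pönitz–Tittmann bounds
`SAW.Zd.BDGS2012_connectiveConstant_two_bounds` (hypothesis `hμ`). [cite: DennisEtAl2002, §4.1 and §5.3] -/
theorem toric_depolarizing_isThresholdLowerBound_PT2000_of_bounds (hμ : SAW.Zd.BDGS2012_connectiveConstant_two_bounds)
    (DX : (L : ℕ) → Decoder (Syndrome (L + 1)) (Chain (L + 1))) (DZ : (L : ℕ) → ZDecoder (L + 1))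
    (hDX : ∀ L, (DX L).IsMinWeight (toricCode (L + 1)).xSyndrome
      ((toricCode (L + 1)).kerZ : Set (Chain (L + 1))) hammingNorm)
    (hDZ : ∀ L, (DZ L).IsMinWeight (syn (L + 1)) (cycles (L + 1)) hammingNorm) :
    IsThresholdLowerBound (depolarizingFailureFamily (fun L => toricCode (L + 1)) DX DZ)
      (3 / 2 * thresholdValue 2.679193) := by
  have hZ : IsThresholdLowerBound (zFailureFamily (fun L => toricCode (L + 1)) DZ) (thresholdValue 2.679193) := by
    rw [zFailureFamily_toricCode]
    exact toricThreshold_PT2000_of_bounds hμ hDZ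
  have h := depolarizing_isThresholdLowerBound (fun L => toricCode (L + 1)) DX DZ
    (toric_x_isThresholdLowerBound_PT2000_of_bounds hμ DX hDX) hZ
    ((min_le_left _ _).trans (thresholdValue_le_two_thirds _))
  rwa [min_self] at h

end Summit.Ventures.QEC.Thresholds
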